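import Mathlib
import HarnessLib
import Summits.RiemannHypothesis.RiemannHypothesis.Theorems.IntegerScrewZetaScrewDatumAdmissible
import Summits.RiemannHypothesis.RiemannHypothesis.Theorems.IntegerScrewZetaScrewSampling

/-!
# Route `IntegerScrew`, LINE «SCREW DEPTH–HEIGHT DICTIONARY» (rh-idea-10/A) — LINE GLUE:
# the diagonal-detection crux implies the line target
# (`ScrewDiagonalDetection` (item `stmt-RiemannHypothesis-21784`) ⟹ `ScrewDetectionDepth`
# (item `stmt-RiemannHypothesis-21800`))

The line files one open crux — EFFECTIVE DIAGONAL DETECTION FOR ABSTRACT ZERO DATA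
(`stmt-RiemannHypothesis-21784`): for every multiplicity datum `Z : ℂ → ℕ` with
`Σ_w Z(w)/|w|² = σ`, support in the open strip `|Re w| < ½` at height `|Im w| ≥ 1`, and local count
`≤ log|T| + 20` on every unit window, each off-line point `w₀` (`Re w₀ > 0`) forces the abstract screw
diagonal `Ψ_Z(L) = Σ_w Z(w)·Re((cosh(wL) − 1)/w²)` below `−1` at some depth
`L ∈ [20, (8/Re w₀)·log((10+σ)(2+|Im w₀|))]` — and one target, the EXPLICIT DETECTION DEPTH for ζ
(`stmt-RiemannHypothesis-21800`): an off-line non-trivial zero `s = ½ + η + iγ` of `ζ` (`η > 0`) forces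
`Ψ(log m) < 0` at an integer depth `2 ≤ m ≤ (11(2+|γ|))^{8/η}`.

This file is the LINE GLUE named in the target's item text («provable logic + arithmetic, first prover
task»): **crux ⟹ target**, by instantiating the crux at ζ's shifted zero datum, which is admissible by
the PROVED support `zetaScrewDatumAdmissible` (item 21806: `σ ≤ 1/20`, strip/height, window count,
`Ψ = Ψ_Z`), and sampling the detected depth `L` at the integer `m = ⌊e^L⌋` by the PROVED support
`zetaScrewSampling` (item 21807: `|Ψ(log m) − Ψ(L)| ≤ ½`).  Arithmetic: `σ ≤ 1/20 ⇒ 10 + σ ≤ 11`,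
`σ ≥ 0` (a sum of non-negative terms) so the logarithm is monotone, and
`m ≤ e^L ≤ exp((8/η)·log(11(2+|γ|))) = (11(2+|γ|))^{8/η}`; finally `Ψ(log m) ≤ Ψ(L) + ½ < −½ < 0`.

Both item signatures are carried VERBATIM (the crux as the hypothesis, the target as the
conclusion), so when the crux closes this theorem closes the target by `modus ponens`.  A second
theorem records the CALIBRATION READING of the target stated in the item text: a certified diagonal
floor `Ψ(log m) ≥ 0` for all `2 ≤ m ≤ M₀` excludes, given the target, every off-line zero with
`(11(2+|γ|))^{8/η} ≤ M₀`.

HONEST LABEL.  The crux (item 21784) is OPEN and is NOT proved here; this file proves only the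
implication.  RH is NOT proved by this file and nothing here bears on the truth of RH.
References: M. Suzuki, *J. Lond. Math. Soc.* (2) 108 (2023) 1448–1487, Thm 1.1 [Suzuki2023];
tree: `Theorems/IntegerScrewZetaScrewDatumAdmissible.lean`, `Theorems/IntegerScrewZetaScrewSampling.lean`,
`Theorems/PfPersistenceFfWeilCriterion.lean` (the function-field model FF1–FF3 of the dictionary).
-/

noncomputable section

-- D-0017: `Summit.<S>.<S>.…` is the designed namespace of a single-problem summit.
set_option linter.dupNamespace false

namespace Summit.RiemannHypothesis.RiemannHypothesis.Theorems.IntegerScrew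

open Literature.NumberTheory.LFunctions

/-- A zero of `ζ` that is not a trivial zero `−2(n+1)` is a non-trivial zero in the sense of
`ZetaZeros.riemannZetaNontrivialZeros` (which is, by definition, Mathlib's `riemannZetaZeros` minus
the trivial zeros). [folklore] -/
theorem mem_nontrivialZeros_of_not_trivial {s : ℂ} (hs : riemannZeta s = 0)
    (hnt : ¬∃ n : ℕ, s = -2 * ((n : ℂ) + 1)) : s ∈ ZetaZeros.riemannZetaNontrivialZeros := by
  refine ⟨mem_riemannZetaZeros.2 hs, ?_⟩
  rintro ⟨n, hn⟩
  exact hnt ⟨n, by rw [← hn]⟩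

/-- The shifted datum does not vanish at `s − ½` when `s` is a non-trivial zero (`Z(s − ½) = m(s) ≥ 1`).
[folklore] -/
theorem datum_shift_ne_zero {Z : ℂ → ℕ} (hZ : ∀ w : ℂ, Z w = Set.indicator ((fun v : ℂ => 1 / 2 + v) ⁻¹'
      ZetaZeros.riemannZetaNontrivialZeros) (fun v : ℂ => (riemannZetaZeroOrder (1 / 2 + v)).toNat) w)
    {s : ℂ} (hs : s ∈ ZetaZeros.riemannZetaNontrivialZeros) : Z (s - 1 / 2) ≠ 0 := by
  have h1 : (Z (s - 1 / 2) : ℝ) = (riemannZetaZeroOrder s : ℝ) := datum_shift_eq hZ hs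
  have h2 := ZetaZeros.riemannZetaNontrivialZeros.one_le_order hs
  intro h0
  rw [h0] at h1
  have h3 : (riemannZetaZeroOrder s : ℝ) = 0 := by exact_mod_cast h1.symm
  have h4 : riemannZetaZeroOrder s = 0 := by exact_mod_cast h3
  omega

/-- Depth arithmetic: `0 ≤ σ ≤ 1/20`, `η > 0`, `L ≤ (8/η)·log((10+σ)(2+|γ|))` and `m ≤ e^L` give
`m ≤ (11(2+|γ|))^{8/η}`. [folklore] -/
theorem depth_le_rpow {σ η γ L x : ℝ} (hσ0 : 0 ≤ σ) (hσ : σ ≤ 1 / 20) (hη : 0 < η)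
    (hL : L ≤ 8 / η * Real.log ((10 + σ) * (2 + |γ|))) (hx : x ≤ Real.exp L) :
    x ≤ (11 * (2 + |γ|)) ^ (8 / η) := by
  have hbase : 0 < 11 * (2 + |γ|) := by positivity
  have hbase' : 0 < (10 + σ) * (2 + |γ|) := by positivity
  have hlog : Real.log ((10 + σ) * (2 + |γ|)) ≤ Real.log (11 * (2 + |γ|)) := by
    refine Real.log_le_log hbase' ?_
    exact mul_le_mul_of_nonneg_right (by linarith) (by positivity)
  have hL' : L ≤ 8 / η * Real.log (11 * (2 + |γ|)) :=
    hL.trans (mul_le_mul_of_nonneg_left hlog (by positivity))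
  calc x ≤ Real.exp L := hx
    _ ≤ Real.exp (8 / η * Real.log (11 * (2 + |γ|))) := Real.exp_le_exp.2 hL'
    _ = (11 * (2 + |γ|)) ^ (8 / η) := by
        rw [Real.rpow_def_of_pos hbase, mul_comm]

/-- **LINE GLUE of «SCREW DEPTH–HEIGHT DICTIONARY»: the crux implies the target.**
`ScrewDiagonalDetection` (item `stmt-RiemannHypothesis-21784`, signature verbatim as the hypothesis)
implies `ScrewDetectionDepth` (item `stmt-RiemannHypothesis-21800`, signature verbatim as the
conclusion): instantiate the abstract datum at ζ's shifted zero datum (`zetaScrewDatumAdmissible`,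
item 21806, PROVED), take `w₀ = s − ½`, read `Ψ(L) = Ψ_Z(L) < −1` at the detected depth
`20 ≤ L ≤ (8/η)·log((10+σ)(2+|γ|))`, sample at `m = ⌊e^L⌋` (`zetaScrewSampling`, item 21807, PROVED):
`Ψ(log m) ≤ Ψ(L) + ½ < 0` and `m ≤ e^L ≤ (11(2+|γ|))^{8/η}` since `0 ≤ σ ≤ 1/20`.  The crux itself is
OPEN; RH is not proved by this and nothing here bears on the truth of RH. -/
theorem screwDetectionDepth_of_screwDiagonalDetection
    (hDet : ∀ (Z : ℂ → ℕ) (σ : ℝ), HasSum (fun w : ℂ => (Z w : ℝ) / ‖w‖ ^ 2) σ → (∀ w : ℂ, Z w ≠ 0 → |w.re| < 1 / 2 ∧ 1 ≤ |w.im|) → (∀ T : ℝ, 1 ≤ |T| → ∑' w : ℂ, (if |w.im - T| ≤ 1 then (Z w : ℝ) else 0) ≤ Real.log |T| + 20) → ∀ w₀ : ℂ, Z w₀ ≠ 0 → 0 < w₀.re → ∃ L : ℝ, 20 ≤ L ∧ L ≤ 8 / w₀.re * Real.log ((10 + σ) * (2 + |w₀.im|)) ∧ ∑' w : ℂ, (Z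 w : ℝ) * ((Complex.cosh (w * L) - 1) / w ^ 2).re < -1) :
    ∀ s : ℂ, riemannZeta s = 0 → (¬∃ n : ℕ, s = -2 * ((n : ℂ) + 1)) → 1 / 2 < s.re → ∃ m : ℕ, 2 ≤ m ∧ (m : ℝ) ≤ (11 * (2 + |s.im|)) ^ (8 / (s.re - 1 / 2)) ∧ Literature.NumberTheory.LFunctions.zetaScrew (Real.log m) < 0 := by
  intro s hs hnt hre
  -- ζ's shifted zero datum and its admissibility (item 21806)
  set Z : ℂ → ℕ := Set.indicator ((fun v : ℂ => 1 / 2 + v) ⁻¹' ZetaZeros.riemannZetaNontrivialZeros)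
    (fun v : ℂ => (riemannZetaZeroOrder (1 / 2 + v)).toNat) with hZdef
  have hZ : ∀ w : ℂ, Z w = Set.indicator ((fun v : ℂ => 1 / 2 + v) ⁻¹'
      ZetaZeros.riemannZetaNontrivialZeros) (fun v : ℂ => (riemannZetaZeroOrder (1 / 2 + v)).toNat) w :=
    fun w => rfl
  obtain ⟨⟨σ, hσle, hσ⟩, hsupp, hwin, hser⟩ := zetaScrewDatumAdmissible Z hZ
  have hσ0 : 0 ≤ σ := hσ.nonneg fun w => by positivity
  -- the off-line point `w₀ = s − ½`
  have hmem : s ∈ ZetaZeros.riemannZetaNontrivialZeros := mem_nontrivialZeros_of_not_trivial hs hnt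
  have hw₀ : Z (s - 1 / 2) ≠ 0 := datum_shift_ne_zero hZ hmem
  have hre' : (s - 1 / 2 : ℂ).re = s.re - 1 / 2 := by simp
  have him' : (s - 1 / 2 : ℂ).im = s.im := by simp
  have hη : 0 < (s - 1 / 2 : ℂ).re := by rw [hre']; linarith
  -- the crux detects: `Ψ_Z(L) < −1` at a depth `20 ≤ L ≤ (8/η) log((10+σ)(2+|γ|))`
  obtain ⟨L, hL20, hLle, hneg⟩ := hDet Z σ hσ hsupp hwin (s - 1 / 2) hw₀ hη
  rw [hre', him'] at hLle
  have hΨL : zetaScrew L < -1 := by rw [hser L]; exact hneg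
  -- integer sampling (item 21807)
  obtain ⟨m, hm2, hmle, hmd⟩ := zetaScrewSampling L hL20
  refine ⟨m, hm2, depth_le_rpow hσ0 hσle (by linarith) hLle hmle, ?_⟩
  have h := (abs_le.1 hmd).2
  linarith

/-- **Calibration reading of the target** (item 21800's text, «a floor to depth `M₀` says nothing about
zeros above height ≈ `M₀^{η/8}/11`», made exact): GIVEN the target `ScrewDetectionDepth` (signature
verbatim as the hypothesis), a certified diagonal floor `Ψ(log m) ≥ 0` for every integer `2 ≤ m ≤ M₀`
excludes every off-line non-trivial zero `s = ½ + η + iγ`, `η > 0`, whose detection depth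
`(11(2+|γ|))^{8/η}` is at most `M₀`.  Pure logic; RH is not proved by this and nothing here bears on
the truth of RH. [folklore] -/
theorem no_offline_zero_below_floor_of_screwDetectionDepth
    (hDepth : ∀ s : ℂ, riemannZeta s = 0 → (¬∃ n : ℕ, s = -2 * ((n : ℂ) + 1)) → 1 / 2 < s.re → ∃ m : ℕ, 2 ≤ m ∧ (m : ℝ) ≤ (11 * (2 + |s.im|)) ^ (8 / (s.re - 1 / 2)) ∧ Literature.NumberTheory.LFunctions.zetaScrew (Real.log m) < 0)
    {M₀ : ℝ} (hfloor : ∀ m : ℕ, 2 ≤ m → (m : ℝ) ≤ M₀ → 0 ≤ zetaScrew (Real.log m))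
    {s : ℂ} (hs : riemannZeta s = 0) (hnt : ¬∃ n : ℕ, s = -2 * ((n : ℂ) + 1)) (hre : 1 / 2 < s.re) :
    M₀ < (11 * (2 + |s.im|)) ^ (8 / (s.re - 1 / 2)) := by
  obtain ⟨m, hm2, hmle, hneg⟩ := hDepth s hs hnt hre
  by_contra hM
  have hmM : (m : ℝ) ≤ M₀ := hmle.trans (not_lt.1 hM)
  exact absurd (hfloor m hm2 hmM) (not_le.2 hneg)

end Summit.RiemannHypothesis.RiemannHypothesis.Theorems.IntegerScrew

end
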